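import Summits.NavierStokesRegularity.FunctionalMining.TopEigTransport
import HarnessLib

/-!
# FunctionalMining — the transport identity for the `λ₁` weight, part 2: LEMMA ADV in selection
# form, the Danskin ends, and the selection production of the static door

Search for candidate a priori estimates; no regularity claim. Cell `pub-nsfunc`, prove seat
(gen 24). Item (D1) "kernel WANTED" of the no-go seat's SELKILL-NOTE §2 (QN4-NOTE LEMMA ADV), on
top of `TopEigTransport.lean` (one-sided channels `W μ(S; ∂ᵤS)`: zero integral, two-sided a.e.).
Notation as there: `v, w` smooth on `T^d`, `div v = div w = 0`, `q ≥ 1`, `W = q λ₁^{q−1}`,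
`S = strainFlat v`, `μ = dirTopEig`, `∂ₖ = Torus.partialDeriv k`.

* §4 `TopEig.topEigWeight_quad_eq_of_twoSided` — at a point where `W μ(A; −N) = −W μ(A; N)`, EVERY
  unit top vector `e` of `A` sees `W eᵀNe = W μ(A; N)` (sandwich `−μ(A; −N) ≤ eᵀNe ≤ μ(A; N)`);
  hence `TopEig.ae_topEigWeight_quad_transport_eq`: for a.e. `x`, every unit top vector `e` of
  `S(v)(x)` and every coefficient field `c`, `W eᵀ(Σₖ cₖ ∂ₖS)e = Σₖ cₖ · W μ(S; ∂ₖS)`.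
* §5 `TopEig.integral_mul_topEigWeight_dirTopEig_lineDeriv` — **integration by parts for the
  one-sided channel**: `∫ h · W μ(S; ∂ᵤS) = −∫ λ₁^q ∂ᵤh` for smooth `h` (the slope integrals
  `∫ h (λ₁^q(· + tu) − λ₁^q)/t = ∫ λ₁^q (h(· − tu) − h)/t` agree for every `t`; dominated convergence on
  both sides); `TopEig.integral_transport_topEigWeight_eq_zero`:
  `∫ Σₖ wₖ · W μ(S; ∂ₖS) = −∫ λ₁^q div w = 0`.
* §6 **`TopEig.integral_topEigWeight_quad_transport_eq_zero`** (LEMMA ADV, selection form): for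
  every field `e` with `e(x)` a unit top vector of `S(v)(x)` a.e. (NO measurability or integrability
  asked), `∫ q λ₁^{q−1} e(x)ᵀ(Σₖ wₖ(x) ∂ₖS(v)(x)) e(x) dx = 0`; the Danskin ends
  `∫ q λ₁^{q−1} μ(S; ±Σₖ wₖ ∂ₖS) dx = 0`
  (`integral_topEigWeight_dirTopEig_transport_eq_zero`, `…_neg_transport_…`).
* §7 **`TopEig.selEulerProduction_eq_integral_hessian`** — for the static door of
  `NoGo/TopEigSaturatingKill`: for smooth divergence-free `w` on `T^d`, `q ≥ 1` and ANY field `e` of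
  unit top vectors of `S(w)` (every heat-maximal selection in particular),
  `𝒫_q(w; e) = ∫ q λ₁^{q−1} eᵀ(−Π(π_w) − N(w))e` — no transport term, whether or not the Hessian
  density is integrable —, and `TopEig.integrable_selEulerDensity_iff`: the door's integrability
  hypothesis is the integrability of this Hessian density.

What is NOT here: any instance of the door (the pen witness W18 / `(F1)` and the measurable
heat-maximal selection stay pen; SELKILL-NOTE (D3)). Refutation bookkeeping for CANDIDATE a priori
inequalities; nothing here is about Navier–Stokes regularity. [ours; Danskin folklore]
-/

noncomputable section

open MeasureTheory Set Filter Topology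

namespace Summit.NavierStokesRegularity.FunctionalMining

open Literature.Analysis.FunctionSpaces Literature.Analysis.FluidPDE

namespace TopEig

open StrainL4 StrainTensor

variable {d : Type*} [Fintype d] [DecidableEq d] [Nonempty d]
variable {v : UnitAddTorus d → EuclideanSpace ℝ d} {q : ℝ}

/-! ## 4. At a two-sided point every top vector sees the same value, channel by channel -/

omit [DecidableEq d] [Nonempty d] in
/-- If `W ≥ 0` and `W μ(A; −N) = −W μ(A; N)`, then `W eᵀNe = W μ(A; N)` for EVERY unit top vector
`e` of `A` (sandwich `−μ(A; −N) ≤ eᵀNe ≤ μ(A; N)`). [ours] -/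
theorem topEigWeight_quad_eq_of_twoSided {A N : EuclideanSpace ℝ (d × d)} {W : ℝ} (hW : 0 ≤ W)
    (h : W * dirTopEig A (-N) = -(W * dirTopEig A N)) {e : d → ℝ} (he : e ∈ topEigSet A) :
    W * quad N e = W * dirTopEig A N := by
  have h1 : W * quad N e ≤ W * dirTopEig A N := mul_le_mul_of_nonneg_left (quad_le_dirTopEig N he) hW
  have h2 : W * quad (-N) e ≤ W * dirTopEig A (-N) :=
    mul_le_mul_of_nonneg_left (quad_le_dirTopEig (-N) he) hW
  have h3 : quad (-N) e = -quad N e := by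
    rw [← neg_one_smul ℝ N, quad_smul, neg_one_mul]
  rw [h, h3] at h2
  linarith

omit [DecidableEq d] [Nonempty d] in
/-- `quad` is additive over finite sums of tensors. [ours] -/
theorem quad_finset_sum {ι : Type*} (s : Finset ι) (f : ι → EuclideanSpace ℝ (d × d)) (e : d → ℝ) :
    quad (∑ k ∈ s, f k) e = ∑ k ∈ s, quad (f k) e := by
  classical
  refine Finset.induction_on s ?_ ?_
  · simp [quad]
  · intro a s ha ih
    rw [Finset.sum_insert ha, Finset.sum_insert ha, quad_add, ih]

omit [DecidableEq d] [Nonempty d] in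
/-- At a point that is two-sided in every channel `N k`, every unit top vector `e` of `A` sees
`W eᵀ(Σₖ cₖ Nₖ)e = Σₖ cₖ · W μ(A; Nₖ)`. [ours] -/
theorem topEigWeight_quad_sum_smul_eq {ι : Type*} [Fintype ι] {A : EuclideanSpace ℝ (d × d)}
    {N : ι → EuclideanSpace ℝ (d × d)} {W : ℝ} (hW : 0 ≤ W)
    (h : ∀ k, W * dirTopEig A (-N k) = -(W * dirTopEig A (N k))) (c : ι → ℝ) {e : d → ℝ}
    (he : e ∈ topEigSet A) :
    W * quad (∑ k, c k • N k) e = ∑ k, c k * (W * dirTopEig A (N k)) := by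
  rw [quad_finset_sum, Finset.mul_sum]
  refine Finset.sum_congr rfl fun k _ => ?_
  rw [quad_smul, mul_left_comm, topEigWeight_quad_eq_of_twoSided hW (h k) he]

/-- **Every top vector sees the transport channels two-sidedly, a.e.** For smooth divergence-free
`v`, `q ≥ 1` and ANY coefficient field `c : T^d → ℝ^d`: for a.e. `x`, every unit top vector `e` of
`S(v)(x)` satisfies `q λ₁^{q−1} eᵀ(Σₖ cₖ(x) ∂ₖS(x))e = Σₖ cₖ(x) · q λ₁^{q−1} μ(S(x); ∂ₖS(x))`. [ours] -/
theorem ae_topEigWeight_quad_transport_eq (hq : 1 ≤ q) (hv : Torus.IsSmooth v) (hdv : Torus.IsDivFree v)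
    (c : UnitAddTorus d → d → ℝ) :
    ∀ᵐ x : UnitAddTorus d, ∀ e ∈ topEigSet (strainFlat v x),
      q * torusStrainTopEig v x ^ (q - 1) *
          quad (∑ k, c x k • Torus.partialDeriv k (strainFlat v) x) e =
        ∑ k, c x k * (q * torusStrainTopEig v x ^ (q - 1) *
          dirTopEig (strainFlat v x) (Torus.partialDeriv k (strainFlat v) x)) := by
  have h := ae_all_iff.2 fun k : d =>
    ae_topEigWeight_dirTopEig_neg_lineDeriv hq hv hdv (EuclideanSpace.single k (1 : ℝ))
  filter_upwards [h] with x hx e he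
  have hl : 0 ≤ torusStrainTopEig v x := by
    rw [← lam_strainFlat]; exact lam_strainFlat_nonneg hv hdv x
  have hW : 0 ≤ q * torusStrainTopEig v x ^ (q - 1) := mul_nonneg (by linarith) (Real.rpow_nonneg hl _)
  exact topEigWeight_quad_sum_smul_eq (N := fun k => Torus.partialDeriv k (strainFlat v) x) hW
    (fun k => hx k) (c x) he

/-! ## 5. Integration by parts for the one-sided channel; the transport integral vanishes -/

/-- **Integration by parts for the one-sided derivative.** For smooth divergence-free `v`, `q ≥ 1`,
smooth `h : T^d → ℝ` and a direction `u`: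
`∫ h · q λ₁^{q−1} μ(S; ∂ᵤS) dx = −∫ λ₁^q ∂ᵤh dx`
(the slope integrals `∫ h (λ₁^q(· + tu) − λ₁^q)/t = ∫ λ₁^q (h(· − tu) − h)/t` agree for every `t`;
dominated convergence on both sides as `t → 0⁺`). [ours] -/
theorem integral_mul_topEigWeight_dirTopEig_lineDeriv (hq : 1 ≤ q) (hv : Torus.IsSmooth v)
    (hdv : Torus.IsDivFree v) {h : UnitAddTorus d → ℝ} (hh : Torus.IsSmooth h) (u : EuclideanSpace ℝ d) :
    ∫ x, h x * (q * torusStrainTopEig v x ^ (q - 1) *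
      dirTopEig (strainFlat v x) (Torus.lineDeriv (strainFlat v) x u)) =
      -∫ x, torusStrainTopEig v x ^ q * Torus.lineDeriv h x u := by
  obtain ⟨C, hC⟩ := exists_abs_rpow_topEig_translate_sub_le hq hv hdv u
  have hg : Continuous fun x => torusStrainTopEig v x ^ q :=
    (continuous_torusStrainTopEig hv).rpow_const fun _ => Or.inr (by linarith)
  have hlimL := tendsto_integral_mul_slope hg hh.continuous hC
    (fun x => hasDerivWithinAt_rpow_topEig_translate hq hv x u)
  -- the weight side: `h` along `−u`
  have hh1 : Torus.IsContDiff 1 h := hh.isContDiff (by simp)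
  obtain ⟨B, hB⟩ := exists_forall_norm_le (hh.lineDeriv (-u)).continuous
  have hC' : ∀ x (t : ℝ), |h (x + Torus.proj (t • (-u))) - h x| ≤ B * |t| := fun x t => by
    have h1 := norm_translate_sub_le hh1 hB x t
    rwa [Real.norm_eq_abs] at h1
  have hderh : ∀ x, HasDerivWithinAt (fun t : ℝ => h (x + Torus.proj (t • (-u))))
      (Torus.lineDeriv h x (-u)) (Ioi 0) 0 := fun x => by
    have h1 := (Torus.hasDerivAt_comp_add_proj_smul hh1 x (-u) 0).hasDerivWithinAt (s := Ioi 0)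
    simp only [zero_smul, Torus.proj_zero, add_zero] at h1
    exact h1
  have hlimR := tendsto_integral_mul_slope hh.continuous hg hC' hderh
  have heq : ∀ t : ℝ, ∫ y, torusStrainTopEig v y ^ q *
      ((h (y + Torus.proj (t • (-u))) - h y) / t) =
      ∫ x, h x * ((torusStrainTopEig v (x + Torus.proj (t • u)) ^ q -
        torusStrainTopEig v x ^ q) / t) := fun t => by
    rw [integral_mul_slope_comm hg hh.continuous (Torus.proj (t • u)) t]
    simp only [add_proj_smul_neg]
  have hlimR' := hlimR.congr heq
  have hLR := tendsto_nhds_unique hlimL hlimR'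
  rw [hLR, ← integral_neg]
  refine integral_congr_ae (ae_of_all _ fun y => ?_)
  simp only [lineDeriv_neg_dir, mul_neg]

omit [DecidableEq d] [Nonempty d] in
/-- A continuous weight times an integrable function is integrable on the torus. [folklore] -/
theorem integrable_continuous_mul {f g : UnitAddTorus d → ℝ} (hf : Continuous f)
    (hg : Integrable g volume) : Integrable (fun x => f x * g x) volume := by
  obtain ⟨C, hC⟩ := exists_forall_norm_le hf
  exact hg.bdd_mul hf.aestronglyMeasurable (ae_of_all _ hC)

/-- **The transport integral vanishes**: for smooth divergence-free `v` and `w` and `q ≥ 1`,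
`∫ Σₖ wₖ · q λ₁^{q−1} μ(S(v); ∂ₖS(v)) dx = −∫ λ₁^q div w dx = 0`. [ours] -/
theorem integral_transport_topEigWeight_eq_zero (hq : 1 ≤ q) (hv : Torus.IsSmooth v)
    (hdv : Torus.IsDivFree v) {w : UnitAddTorus d → EuclideanSpace ℝ d} (hw : Torus.IsSmooth w)
    (hdw : Torus.IsDivFree w) :
    ∫ x, ∑ k, w x k * (q * torusStrainTopEig v x ^ (q - 1) *
      dirTopEig (strainFlat v x) (Torus.partialDeriv k (strainFlat v) x)) = 0 := by
  have hS := isSmooth_strainFlat hv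
  have hint : ∀ k, Integrable (fun x => w x k * (q * torusStrainTopEig v x ^ (q - 1) *
      dirTopEig (strainFlat v x) (Torus.partialDeriv k (strainFlat v) x))) volume := fun k =>
    integrable_continuous_mul (hw.apply k).continuous
      (integrable_topEigDensity hq hv hdv (hS.partialDeriv k).continuous)
  have hk : ∀ k, ∫ x, w x k * (q * torusStrainTopEig v x ^ (q - 1) *
      dirTopEig (strainFlat v x) (Torus.partialDeriv k (strainFlat v) x)) =
      -∫ x, torusStrainTopEig v x ^ q * Torus.partialDeriv k (fun y => w y k) x := fun k =>
    integral_mul_topEigWeight_dirTopEig_lineDeriv hq hv hdv (hw.apply k) (EuclideanSpace.single k 1)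
  have hg : Continuous fun x => torusStrainTopEig v x ^ q :=
    (continuous_torusStrainTopEig hv).rpow_const fun _ => Or.inr (by linarith)
  have hint' : ∀ k, Integrable (fun x => torusStrainTopEig v x ^ q *
      Torus.partialDeriv k (fun y => w y k) x) volume := fun k =>
    (hg.mul ((hw.apply k).partialDeriv k).continuous).integrable_unitAddTorus
  rw [integral_finsetSum _ fun k _ => hint k]
  simp only [hk]
  rw [Finset.sum_neg_distrib, ← integral_finsetSum _ fun k _ => hint' k, neg_eq_zero]
  have hdiv : ∀ x, ∑ k, torusStrainTopEig v x ^ q * Torus.partialDeriv k (fun y => w y k) x = 0 :=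
    fun x => by
    rw [← Finset.mul_sum]
    have h0 : Torus.divergence w x = 0 := hdw x
    rw [Torus.divergence] at h0
    rw [h0, mul_zero]
  simp only [hdiv, integral_zero]

/-! ## 6. LEMMA ADV (selection form) and the Danskin ends -/

/-- **LEMMA ADV, selection form.** For smooth divergence-free `v, w` on `T^d`, real `q ≥ 1` and ANY
field `e` with `e(x)` a unit top vector of `S(v)(x)` for a.e. `x` (no measurability, no integrability
asked): `∫ q λ₁^{q−1} e(x)ᵀ (Σₖ wₖ(x) ∂ₖS(v)(x)) e(x) dx = 0`. Search for candidate a priori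
estimates; no regularity claim. [ours; QN4-NOTE LEMMA ADV of the no-go seat, in the kernel] -/
theorem integral_topEigWeight_quad_transport_eq_zero (hq : 1 ≤ q) (hv : Torus.IsSmooth v)
    (hdv : Torus.IsDivFree v) {w : UnitAddTorus d → EuclideanSpace ℝ d} (hw : Torus.IsSmooth w)
    (hdw : Torus.IsDivFree w) {e : UnitAddTorus d → d → ℝ}
    (he : ∀ᵐ x : UnitAddTorus d, e x ∈ topEigSet (strainFlat v x)) :
    ∫ x, q * torusStrainTopEig v x ^ (q - 1) *
      quad (∑ k, w x k • Torus.partialDeriv k (strainFlat v) x) (e x) = 0 := by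
  rw [← integral_transport_topEigWeight_eq_zero hq hv hdv hw hdw]
  refine integral_congr_ae ?_
  filter_upwards [ae_topEigWeight_quad_transport_eq hq hv hdv (fun x k => w x k), he] with x hx hex
  exact hx (e x) hex

/-- **The upper Danskin end of the transport vanishes**: `∫ q λ₁^{q−1} μ(S; Σₖ wₖ ∂ₖS) dx = 0`
(choose a maximising top vector at each point). [ours; LEMMA ADV] -/
theorem integral_topEigWeight_dirTopEig_transport_eq_zero (hq : 1 ≤ q) (hv : Torus.IsSmooth v)
    (hdv : Torus.IsDivFree v) {w : UnitAddTorus d → EuclideanSpace ℝ d} (hw : Torus.IsSmooth w)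
    (hdw : Torus.IsDivFree w) :
    ∫ x, q * torusStrainTopEig v x ^ (q - 1) *
      dirTopEig (strainFlat v x) (∑ k, w x k • Torus.partialDeriv k (strainFlat v) x) = 0 := by
  choose e he heq using fun x =>
    exists_quad_eq_dirTopEig (strainFlat v x) (∑ k, w x k • Torus.partialDeriv k (strainFlat v) x)
  have h := integral_topEigWeight_quad_transport_eq_zero hq hv hdv hw hdw (e := e) (ae_of_all _ he)
  simp only [heq] at h
  exact h

/-- **The lower Danskin end of the transport vanishes**: `∫ q λ₁^{q−1} μ(S; −Σₖ wₖ ∂ₖS) dx = 0`.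
[ours; LEMMA ADV] -/
theorem integral_topEigWeight_dirTopEig_neg_transport_eq_zero (hq : 1 ≤ q) (hv : Torus.IsSmooth v)
    (hdv : Torus.IsDivFree v) {w : UnitAddTorus d → EuclideanSpace ℝ d} (hw : Torus.IsSmooth w)
    (hdw : Torus.IsDivFree w) :
    ∫ x, q * torusStrainTopEig v x ^ (q - 1) *
      dirTopEig (strainFlat v x) (-∑ k, w x k • Torus.partialDeriv k (strainFlat v) x) = 0 := by
  choose e he heq using fun x =>
    exists_quad_eq_dirTopEig (strainFlat v x) (-∑ k, w x k • Torus.partialDeriv k (strainFlat v) x)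
  have h := integral_topEigWeight_quad_transport_eq_zero hq hv hdv hw hdw (e := e) (ae_of_all _ he)
  have hneg : ∀ x, q * torusStrainTopEig v x ^ (q - 1) *
      dirTopEig (strainFlat v x) (-∑ k, w x k • Torus.partialDeriv k (strainFlat v) x) =
      -(q * torusStrainTopEig v x ^ (q - 1) *
        quad (∑ k, w x k • Torus.partialDeriv k (strainFlat v) x) (e x)) := fun x => by
    rw [← heq x, ← neg_one_smul ℝ (∑ k, w x k • Torus.partialDeriv k (strainFlat v) x), quad_smul]
    ring
  simp only [hneg, integral_neg, h, neg_zero]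

/-! ## 7. Consequence for the static door: the selection production has no transport term -/

/-- **`𝒫_q(w; e) = ∫ q λ₁^{q−1} eᵀ(−Π(π_w) − N(w))e`** for smooth divergence-free `w` on `T^d`,
`q ≥ 1` and ANY field `e` of unit top vectors of `S(w)` (in particular every heat-maximal selection):
the transport part of `E_w` integrates to zero through `e` (LEMMA ADV), whether or not the
Hessian density is integrable (if it is not, both sides are the junk value `0`). Refutation
bookkeeping for a CANDIDATE inequality; nothing about regularity. [ours] -/
theorem selEulerProduction_eq_integral_hessian (hq : 1 ≤ q) {w : UnitAddTorus d → EuclideanSpace ℝ d}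
    (hw : Torus.IsSmooth w) (hdw : Torus.IsDivFree w) {e : UnitAddTorus d → d → ℝ}
    (he : ∀ x, e x ∈ topEigSet (strainFlat w x)) :
    selEulerProduction q w e = ∫ x, q * torusStrainTopEig w x ^ (q - 1) *
      quad (-pressVec (pressureOf w) x - nonlinVec w x) (e x) := by
  have hτ_ae := ae_topEigWeight_quad_transport_eq hq hw hdw (fun x k => w x k)
  have hτ_int : Integrable (fun x => q * torusStrainTopEig w x ^ (q - 1) *
      quad (∑ k, w x k • Torus.partialDeriv k (strainFlat w) x) (e x)) volume := by
    have hS := isSmooth_strainFlat hw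
    have h1 : Integrable (fun x => ∑ k, w x k * (q * torusStrainTopEig w x ^ (q - 1) *
        dirTopEig (strainFlat w x) (Torus.partialDeriv k (strainFlat w) x))) volume :=
      integrable_finsetSum _ fun k _ => integrable_continuous_mul (hw.apply k).continuous
        (integrable_topEigDensity hq hw hdw (hS.partialDeriv k).continuous)
    refine h1.congr ?_
    filter_upwards [hτ_ae] with x hx
    exact (hx (e x) (he x)).symm
  have hτ0 := integral_topEigWeight_quad_transport_eq_zero hq hw hdw hw hdw (e := e) (ae_of_all _ he)
  have hsplit : ∀ x, q * torusStrainTopEig w x ^ (q - 1) * quad (eulerStrainVec w x) (e x) =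
      q * torusStrainTopEig w x ^ (q - 1) * quad (-pressVec (pressureOf w) x - nonlinVec w x) (e x) -
      q * torusStrainTopEig w x ^ (q - 1) *
        quad (∑ k, w x k • Torus.partialDeriv k (strainFlat w) x) (e x) := fun x => by
    rw [eulerStrainVec, quad_sub, mul_sub]
  unfold selEulerProduction
  simp only [hsplit]
  by_cases hH : Integrable (fun x => q * torusStrainTopEig w x ^ (q - 1) *
      quad (-pressVec (pressureOf w) x - nonlinVec w x) (e x)) volume
  · rw [integral_sub hH hτ_int, hτ0, sub_zero]
  · have hH' : ¬ Integrable (fun x => q * torusStrainTopEig w x ^ (q - 1) *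
        quad (-pressVec (pressureOf w) x - nonlinVec w x) (e x) -
        q * torusStrainTopEig w x ^ (q - 1) *
        quad (∑ k, w x k • Torus.partialDeriv k (strainFlat w) x) (e x)) volume := fun h =>
      hH ((h.add hτ_int).congr (ae_of_all _ fun x => by simp only [Pi.add_apply, sub_add_cancel]))
    rw [integral_undef hH, integral_undef hH']

/-- **The door's integrability hypothesis is the integrability of the Hessian density**: for smooth
divergence-free `w`, `q ≥ 1` and any field `e` of unit top vectors of `S(w)`,
`x ↦ q λ₁^{q−1} eᵀE_we` is integrable iff `x ↦ q λ₁^{q−1} eᵀ(−Π(π_w) − N(w))e` is. [ours] -/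
theorem integrable_selEulerDensity_iff (hq : 1 ≤ q) {w : UnitAddTorus d → EuclideanSpace ℝ d}
    (hw : Torus.IsSmooth w) (hdw : Torus.IsDivFree w) {e : UnitAddTorus d → d → ℝ}
    (he : ∀ x, e x ∈ topEigSet (strainFlat w x)) :
    Integrable (fun x => q * torusStrainTopEig w x ^ (q - 1) * quad (eulerStrainVec w x) (e x)) volume ↔
      Integrable (fun x => q * torusStrainTopEig w x ^ (q - 1) *
        quad (-pressVec (pressureOf w) x - nonlinVec w x) (e x)) volume := by
  have hτ_ae := ae_topEigWeight_quad_transport_eq hq hw hdw (fun x k => w x k)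
  have hτ_int : Integrable (fun x => q * torusStrainTopEig w x ^ (q - 1) *
      quad (∑ k, w x k • Torus.partialDeriv k (strainFlat w) x) (e x)) volume := by
    have hS := isSmooth_strainFlat hw
    have h1 : Integrable (fun x => ∑ k, w x k * (q * torusStrainTopEig w x ^ (q - 1) *
        dirTopEig (strainFlat w x) (Torus.partialDeriv k (strainFlat w) x))) volume :=
      integrable_finsetSum _ fun k _ => integrable_continuous_mul (hw.apply k).continuous
        (integrable_topEigDensity hq hw hdw (hS.partialDeriv k).continuous)
    refine h1.congr ?_
    filter_upwards [hτ_ae] with x hx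
    exact (hx (e x) (he x)).symm
  have hsplit : (fun x => q * torusStrainTopEig w x ^ (q - 1) * quad (eulerStrainVec w x) (e x)) =
      fun x => q * torusStrainTopEig w x ^ (q - 1) *
        quad (-pressVec (pressureOf w) x - nonlinVec w x) (e x) -
      q * torusStrainTopEig w x ^ (q - 1) *
        quad (∑ k, w x k • Torus.partialDeriv k (strainFlat w) x) (e x) := by
    funext x; rw [eulerStrainVec, quad_sub, mul_sub]
  rw [hsplit]
  constructor
  · intro h
    exact (h.add hτ_int).congr (ae_of_all _ fun x => by simp only [Pi.add_apply, sub_add_cancel])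
  · intro h; exact h.sub hτ_int

end TopEig

end Summit.NavierStokesRegularity.FunctionalMining

end
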